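import Summits.Ventures.PercRepro.CycleMS
import Summits.Ventures.PercRepro.MS3Regime
import Summits.Ventures.PercRepro.ThetaTwoPairs

/-!
# The set-world (Θ) theorems in the cell's typed form (`famD`, CYCLE-MS′)

`CycleMS.lean` states the cell's CYCLE-MS′ / (Θ) for families of configurations `Config S`
with the difference family `famD A B C`; `ThetaSet.lean` / `ThetaTwoPairs.lean` prove the
regime theorems for families of finsets with `thetaD`. The indicator map `toFinset` is a
Boolean-algebra isomorphism `Config S ≃ Finset S` (`toFinset_compl`, `toFinset_inf`,
`toFinset_join`), so `famD` maps onto `thetaD` (`image_toFinset_famD`) and the six-family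
disjointness becomes `ThetaValid` (`thetaValid_of_pairwise`). Hence, in the typed form of
record: **CYCLE-MS′ holds whenever some type has at most one pair**
(`cycleMS_of_some_card_le_one`, unconditional) and **whenever some type has at most two pairs,
modulo Conjecture V** (`cycleMS_of_some_card_le_two_of_conjV`).
-/

namespace PercRepro

open Finset
open scoped FinsetFamily

variable {S : Type} [Fintype S] [DecidableEq S]

/-- The indicator map commutes with joins. -/
theorem toFinset_join (A B : Config S) : toFinset (A ⊔ B) = toFinset A ∪ toFinset B := by
  ext i
  simp only [mem_toFinset, Finset.mem_union, Pi.sup_apply]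
  cases A i <;> cases B i <;> decide

/-- The indicator image of the complement family. -/
theorem image_toFinset_famCompl (X : Finset (Config S)) :
    (famCompl X).image toFinset = MSTight.compls (X.image toFinset) := by
  unfold famCompl MSTight.compls
  rw [Finset.image_image, Finset.image_image]
  congr 1
  funext x
  exact toFinset_compl x

/-- The indicator image of a difference family. -/
theorem image_toFinset_famDiff (X Y : Finset (Config S)) :
    (famDiff X Y).image toFinset = (X.image toFinset) \\ (Y.image toFinset) := by
  ext E
  simp only [Finset.mem_image, mem_famDiff, Finset.mem_diffs]
  constructor
  · rintro ⟨_, ⟨x, hx, y, hy, rfl⟩, rfl⟩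
    refine ⟨toFinset x, ⟨x, hx, rfl⟩, toFinset y, ⟨y, hy, rfl⟩, ?_⟩
    rw [toFinset_inf, toFinset_compl]
    ext i; simp
  · rintro ⟨_, ⟨x, hx, rfl⟩, _, ⟨y, hy, rfl⟩, rfl⟩
    refine ⟨x ⊓ yᶜ, ⟨x, hx, y, hy, rfl⟩, ?_⟩
    rw [toFinset_inf, toFinset_compl]
    ext i; simp

/-- The indicator image of a meet family. -/
theorem image_toFinset_famMeet (X Y : Finset (Config S)) :
    (famMeet X Y).image toFinset = (X.image toFinset) ⊼ (Y.image toFinset) := by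
  ext E
  simp only [Finset.mem_image, mem_famMeet, Finset.mem_infs]
  constructor
  · rintro ⟨_, ⟨x, hx, y, hy, rfl⟩, rfl⟩
    exact ⟨toFinset x, ⟨x, hx, rfl⟩, toFinset y, ⟨y, hy, rfl⟩, by rw [toFinset_inf, inf_eq_inter]⟩
  · rintro ⟨_, ⟨x, hx, rfl⟩, _, ⟨y, hy, rfl⟩, rfl⟩
    exact ⟨x ⊓ y, ⟨x, hx, y, hy, rfl⟩, by rw [toFinset_inf, inf_eq_inter]⟩

/-- The indicator image of a join-complement family. -/
theorem image_toFinset_famJoinCompl (X Y : Finset (Config S)) :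
    (famJoinCompl X Y).image toFinset = MSTight.compls ((X.image toFinset) ⊻ (Y.image toFinset)) := by
  ext E
  simp only [Finset.mem_image, mem_famJoinCompl, MSTight.mem_compls, Finset.mem_sups]
  constructor
  · rintro ⟨_, ⟨x, hx, y, hy, rfl⟩, rfl⟩
    refine ⟨toFinset x, ⟨x, hx, rfl⟩, toFinset y, ⟨y, hy, rfl⟩, ?_⟩
    rw [toFinset_compl, toFinset_join, Finset.sdiff_sdiff_eq_self (subset_univ _), sup_eq_union]
  · rintro ⟨_, ⟨x, hx, rfl⟩, _, ⟨y, hy, rfl⟩, h⟩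
    refine ⟨(x ⊔ y)ᶜ, ⟨x, hx, y, hy, rfl⟩, ?_⟩
    rw [sup_eq_union] at h
    rw [toFinset_compl, toFinset_join, h, Finset.sdiff_sdiff_eq_self (subset_univ _)]

/-- **The bridge**: the indicator image of `famD` is `thetaD` of the indicator images. -/
theorem image_toFinset_famD (A B C : Finset (Config S)) :
    (famD A B C).image toFinset =
      MSTight.thetaD (A.image toFinset) (B.image toFinset) (C.image toFinset) := by
  unfold famD MSTight.thetaD
  simp only [Finset.image_union, image_toFinset_famDiff, image_toFinset_famMeet,
    image_toFinset_famJoinCompl]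

/-- The indicator images of pairwise disjoint families are disjoint. -/
theorem disjoint_image_toFinset {X Y : Finset (Config S)} (h : Disjoint X Y) :
    Disjoint (X.image toFinset) (Y.image toFinset) :=
  Finset.disjoint_image toFinset_injective |>.2 h

/-- The six-family disjointness becomes `ThetaValid` of the indicator images. -/
theorem thetaValid_of_pairwise {A B C : Finset (Config S)}
    (hd : [A, B, C, famCompl A, famCompl B, famCompl C].Pairwise Disjoint) :
    MSTight.ThetaValid (A.image toFinset) (B.image toFinset) (C.image toFinset) := by
  rw [List.pairwise_cons] at hd
  obtain ⟨hA, hd⟩ := hd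
  rw [List.pairwise_cons] at hd
  obtain ⟨hB, hd⟩ := hd
  rw [List.pairwise_cons] at hd
  obtain ⟨hC, -⟩ := hd
  have hAB : Disjoint A B := hA _ (by simp)
  have hAA' : Disjoint A (famCompl A) := hA _ (by simp)
  have hAB' : Disjoint A (famCompl B) := hA _ (by simp)
  have hBC : Disjoint B C := hB _ (by simp)
  have hBB' : Disjoint B (famCompl B) := hB _ (by simp)
  have hBC' : Disjoint B (famCompl C) := hB _ (by simp)
  have hCA : Disjoint A C := hA _ (by simp)
  have hCA' : Disjoint C (famCompl A) := hC _ (by simp)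
  have hCC' : Disjoint C (famCompl C) := hC _ (by simp)
  refine ⟨?_, ?_, ?_, disjoint_image_toFinset hAB, disjoint_image_toFinset hBC,
    disjoint_image_toFinset hCA.symm, ?_, ?_, ?_⟩
  · rw [← image_toFinset_famCompl]; exact disjoint_image_toFinset hAA'
  · rw [← image_toFinset_famCompl]; exact disjoint_image_toFinset hBB'
  · rw [← image_toFinset_famCompl]; exact disjoint_image_toFinset hCC'
  · rw [← image_toFinset_famCompl]; exact disjoint_image_toFinset hAB'
  · rw [← image_toFinset_famCompl]; exact disjoint_image_toFinset hBC'
  · rw [← image_toFinset_famCompl]; exact disjoint_image_toFinset hCA'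

/-- `|X.image toFinset| = |X|`. -/
theorem card_image_toFinset (X : Finset (Config S)) : (X.image toFinset).card = X.card :=
  Finset.card_image_of_injective _ toFinset_injective

/-- **CYCLE-MS′ whenever some type has at most one pair** (the typed form of
`theta_card_le_of_some_card_le_one`). -/
theorem cycleMS_of_some_card_le_one (A B C : Finset (Config S))
    (hd : [A, B, C, famCompl A, famCompl B, famCompl C].Pairwise Disjoint)
    (hsmall : A.card ≤ 1 ∨ B.card ≤ 1 ∨ C.card ≤ 1) :
    A.card + B.card + C.card ≤ (famD A B C).card := by
  have h := MSTight.theta_card_le_of_some_card_le_one (thetaValid_of_pairwise hd)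
    (by simpa [card_image_toFinset] using hsmall)
  rw [← image_toFinset_famD, card_image_toFinset, card_image_toFinset, card_image_toFinset,
    card_image_toFinset] at h
  exact h

/-- **CYCLE-MS′ whenever some type has at most two pairs, modulo Conjecture V** (the typed form
of `theta_card_le_of_some_card_le_two_of_conjV`). -/
theorem cycleMS_of_some_card_le_two_of_conjV (hV : MSTight.ConjV S) (A B C : Finset (Config S))
    (hd : [A, B, C, famCompl A, famCompl B, famCompl C].Pairwise Disjoint)
    (hsmall : A.card ≤ 2 ∨ B.card ≤ 2 ∨ C.card ≤ 2) :
    A.card + B.card + C.card ≤ (famD A B C).card := by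
  have h := MSTight.theta_card_le_of_some_card_le_two_of_conjV hV (thetaValid_of_pairwise hd)
    (by simpa [card_image_toFinset] using hsmall)
  rw [← image_toFinset_famD, card_image_toFinset, card_image_toFinset, card_image_toFinset,
    card_image_toFinset] at h
  exact h

end PercRepro
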